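import Mathlib
import HarnessLib
import Literature.MathematicalPhysics.KineticTheory.HardSphereEuler
import Literature.MathematicalPhysics.KineticTheory.BackwardCluster
import Literature.MathematicalPhysics.KineticTheory.HardSphereEulerProofs
import Summits.AtomisticToContinuum.HydrodynamicLimit.Theses.RelayRaceLocality
import Summits.AtomisticToContinuum.HydrodynamicLimit.Theorems.RelayRaceLocalityGibbsLightConeSimpleChainBridge
import Summits.AtomisticToContinuum.HydrodynamicLimit.Theorems.RelayRaceLocalityGibbsLightConeLinkGlueSlab
import Summits.AtomisticToContinuum.HydrodynamicLimit.Theorems.RelayRaceLocalityGibbsLightConeHotGlueSlab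
import Summits.AtomisticToContinuum.HydrodynamicLimit.Theorems.RelayRaceLocalityGibbsLightConeStubPairSlabContact

/-!
# `RelayRaceLocality.GibbsLightCone` (stmt-AtomisticToContinuum-12501) from the two multi-time seams
of the line `Sketch` (skeleton revision 15): the CONDITIONAL closure, sorry-free

Helper file (`--supports stmt-AtomisticToContinuum-12501`). The line `Sketch` (card
`log-window-tagged-tail`) has reduced the crux — the equilibrium Lieb–Robinson cone for hard spheres at
fixed reduced density — through 26 accepted files to the conjunction of two MULTI-TIME bounds for the
deterministic flow under the invariant Gibbs law, the registered stubs of `Cruxes/GibbsLightCone/Lines/Sketch.lean`: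

* `X″` from two links on (`stub_slabContactNecklaceBound_two_le`): along an injective label chain of
  `n ≥ 2` links, the Gibbs probability that every consecutive pair is in contact at some time of its slab
  (slabs of width `Δ ≤ ε_N/√θ`, ordered start times inside a window of `M ≤ K log(N+2)` mean free times)
  is at most `(C₁ (ε_N + Λ√θΔ)³)ⁿ`, eventually in `N`;
* `Y″` (`stub_tiltedSlabContactNecklaceBound`): the same event together with a hot path length of the
  carriers above `y ℓ_N` costs an extra factor `C₂ e^{c₂M} e^{-ηy}`.

This file turns the skeleton's composition into tree theorems with the two stubs as explicit hypotheses: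
`slabContactNecklaceBound_of_two_le` assembles `X″` for ALL `n` from the landed first-moment anchor
`stub_pairSlabContact` (`n = 1`, Campbell/flux bound, p133335), the trivial case `n = 0` and the hypothesis
`n ≥ 2`; `gibbsLightCone_of_seams` is the landed two-hypothesis bridge
`gibbsLightCone_of_hotPathLengthTail_of_linkCountTail` (p126888) after the landed glues
`stub_hotPathLengthTail_of_tiltedSlabContactNecklaceBound` (H″, p130554) and
`stub_linkCountTail_of_slabContactNecklaceBound` (L″, p130411). Consequently the crux closes from two
item signatures — the hypotheses below, verbatim the registered stub signatures — with no further Lean.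
Neither hypothesis is claimed here: both are N-uniform dynamical statements (multi-slab collision
moments; hot-flight survival damping) for which no theorem exists at fixed reduced density.
-/

namespace Summit.AtomisticToContinuum.HydrodynamicLimit.Theorems.LogWindowTaggedTail

open Literature.MathematicalPhysics.KineticTheory Literature.Analysis.FluidPDE MeasureTheory Filter Set

open scoped ENNReal

/-- SLAB-CONTACT NECKLACE BOUND `X″` FOR ALL `n` FROM ITS `n ≥ 2` PART (the hypothesis of glue L″,
`stub_linkCountTail_of_slabContactNecklaceBound`): `n = 0` is `G_N ≤ 1`, `n = 1` is the landed anchor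
`stub_pairSlabContact` with `C ε²√θΔ ≤ C (ε + Λ√θΔ)³` (`Λ ≥ 1`), `n ≥ 2` is the hypothesis; constants
`min(σ₀, 1/2)`, `max(C₁, C)`, `Λ`. Proof verbatim from the skeleton `Lines/Sketch.lean` rev 15. [folklore] -/
theorem slabContactNecklaceBound_of_two_le
    (hX :
      ∀ a θ : ℝ, 0 < a → 0 < θ → ∃ σ₀ : ℝ, 0 < σ₀ ∧ ∃ C₁ Λ : ℝ, 0 ≤ C₁ ∧ 1 ≤ Λ ∧ ∀ K : ℝ, 0 < K →
        ∀ σ : ℝ, 0 < σ → σ < σ₀ →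
        ∀ Φ : (N : ℕ) → HardSphereFlow (Torus.geometry (Fin 3)) (hsDiameter σ N) (N + 1),
        ∀ᶠ N : ℕ in atTop, ∀ M : ℝ, 1 ≤ M → M ≤ K * Real.log ((N : ℝ) + 2) →
          ∀ Δ : ℝ, 0 < Δ → Δ ≤ hsDiameter σ N / Real.sqrt θ →
          ∀ (n : ℕ) (q : Fin (n + 1) → Fin (N + 1)) (T : Fin (n + 2) → ℝ), 2 ≤ n →
            Function.Injective q → Monotone T → T 0 = 0 →
            T (Fin.last (n + 1)) = M * (((N + 1 : ℕ) : ℝ) ^ (-(1 / 3 : ℝ)) / σ ^ 2 / Real.sqrt θ) →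
          localGibbsLaw σ (fun _ => a) (fun _ => 0) (fun _ => θ) N (Φ N)
            {z | ∀ m : Fin n, ∃ u ∈ Set.Icc (T (Fin.castSucc (Fin.succ m))) (T (Fin.castSucc (Fin.succ m)) + Δ),
                s(q (Fin.castSucc m), q (Fin.succ m)) ∈
                  contactPairSet (Torus.geometry (Fin 3)) (hsDiameter σ N) ((Φ N).flow u z)}
            ≤ ENNReal.ofReal ((C₁ * (hsDiameter σ N + Λ * Real.sqrt θ * Δ) ^ 3) ^ n)) :
    ∀ a θ : ℝ, 0 < a → 0 < θ → ∃ σ₀ : ℝ, 0 < σ₀ ∧ ∃ C₁ Λ : ℝ, 1 ≤ Λ ∧ ∀ K : ℝ, 0 < K →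
      ∀ σ : ℝ, 0 < σ → σ < σ₀ →
      ∀ Φ : (N : ℕ) → HardSphereFlow (Torus.geometry (Fin 3)) (hsDiameter σ N) (N + 1),
      ∀ᶠ N : ℕ in atTop, ∀ M : ℝ, 1 ≤ M → M ≤ K * Real.log ((N : ℝ) + 2) →
        ∀ Δ : ℝ, 0 < Δ → Δ ≤ hsDiameter σ N / Real.sqrt θ →
        ∀ (n : ℕ) (q : Fin (n + 1) → Fin (N + 1)) (T : Fin (n + 2) → ℝ),
          Function.Injective q → Monotone T → T 0 = 0 →
          T (Fin.last (n + 1)) = M * (((N + 1 : ℕ) : ℝ) ^ (-(1 / 3 : ℝ)) / σ ^ 2 / Real.sqrt θ) →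
        localGibbsLaw σ (fun _ => a) (fun _ => 0) (fun _ => θ) N (Φ N)
          {z | ∀ m : Fin n, ∃ u ∈ Set.Icc (T (Fin.castSucc (Fin.succ m))) (T (Fin.castSucc (Fin.succ m)) + Δ),
              s(q (Fin.castSucc m), q (Fin.succ m)) ∈
                contactPairSet (Torus.geometry (Fin 3)) (hsDiameter σ N) ((Φ N).flow u z)}
          ≤ ENNReal.ofReal ((C₁ * (hsDiameter σ N + Λ * Real.sqrt θ * Δ) ^ 3) ^ n) := by
  obtain ⟨C, hC, hpair⟩ := stub_pairSlabContact
  intro a θ ha hθ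
  obtain ⟨σ₀, hσ₀, C₁, Λ, hC₁, hΛ, htwo⟩ := hX a θ ha hθ
  refine ⟨min σ₀ (1 / 2), lt_min hσ₀ (by norm_num), max C₁ C, Λ, hΛ, ?_⟩
  intro K hK σ hσ hσlt Φ
  have hσ₀' : σ < σ₀ := lt_of_lt_of_le hσlt (min_le_left _ _)
  have hσhalf : σ ≤ 1 / 2 := (lt_of_lt_of_le hσlt (min_le_right _ _)).le
  filter_upwards [htwo K hK σ hσ hσ₀' Φ] with N hN
  intro M hM hMK Δ hΔ hΔε n q T hq hT hT0 hTlast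
  have hε : 0 < hsDiameter σ N := hsDiameter_pos hσ N
  have hB : 0 ≤ hsDiameter σ N + Λ * Real.sqrt θ * Δ := by
    have : 0 ≤ Λ * Real.sqrt θ * Δ := by positivity
    linarith
  rcases n with _ | _ | n
  · -- no link: the event is everything, the bound is `1`
    haveI := isProbabilityMeasure_localGibbsLaw (a₀ := fun _ => a) (θ₀ := fun _ => θ)
      (u₀ := fun _ => (0 : V3)) continuous_const continuous_const continuous_const
      (fun _ => ha) (fun _ => hθ) hσhalf N (Φ N)
    calc localGibbsLaw σ (fun _ => a) (fun _ => 0) (fun _ => θ) N (Φ N) _ ≤ 1 := prob_le_one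
      _ = ENNReal.ofReal ((max C₁ C * (hsDiameter σ N + Λ * Real.sqrt θ * Δ) ^ 3) ^ 0) := by
          rw [pow_zero, ENNReal.ofReal_one]
  · -- one link: the anchor
    have hq01 : q (Fin.castSucc (0 : Fin 1)) ≠ q (Fin.succ (0 : Fin 1)) := by
      intro h
      exact absurd (hq h) (by decide)
    have h1 := hpair a θ ha hθ σ hσ hσhalf N (Φ N) _ _ hq01 (T (Fin.castSucc (Fin.succ (0 : Fin 1)))) Δ hΔ
    calc localGibbsLaw σ (fun _ => a) (fun _ => 0) (fun _ => θ) N (Φ N) _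
        ≤ localGibbsLaw σ (fun _ => a) (fun _ => 0) (fun _ => θ) N (Φ N)
            {z | ∃ u ∈ Set.Icc (T (Fin.castSucc (Fin.succ (0 : Fin 1))))
                (T (Fin.castSucc (Fin.succ (0 : Fin 1))) + Δ),
              s(q (Fin.castSucc (0 : Fin 1)), q (Fin.succ (0 : Fin 1))) ∈
                contactPairSet (Torus.geometry (Fin 3)) (hsDiameter σ N) ((Φ N).flow u z)} :=
          measure_mono fun z hz => by simp only [Set.mem_setOf_eq] at hz ⊢; exact hz 0
      _ ≤ ENNReal.ofReal (C * (hsDiameter σ N ^ 2 * Real.sqrt θ * Δ)) := h1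
      _ ≤ ENNReal.ofReal ((max C₁ C * (hsDiameter σ N + Λ * Real.sqrt θ * Δ) ^ 3) ^ (0 + 1)) := by
          refine ENNReal.ofReal_le_ofReal ?_
          rw [zero_add, pow_one]
          have hx : 0 ≤ Real.sqrt θ * Δ := by positivity
          have hcube : hsDiameter σ N ^ 2 * Real.sqrt θ * Δ ≤
              (hsDiameter σ N + Λ * Real.sqrt θ * Δ) ^ 3 := by
            have h2 : hsDiameter σ N ^ 2 ≤ (hsDiameter σ N + Λ * Real.sqrt θ * Δ) ^ 2 := by
              refine pow_le_pow_left₀ hε.le ?_ 2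
              have : 0 ≤ Λ * Real.sqrt θ * Δ := by positivity
              linarith
            have h3 : Real.sqrt θ * Δ ≤ hsDiameter σ N + Λ * Real.sqrt θ * Δ := by
              have : Real.sqrt θ * Δ ≤ Λ * (Real.sqrt θ * Δ) := le_mul_of_one_le_left hx hΛ
              nlinarith
            calc hsDiameter σ N ^ 2 * Real.sqrt θ * Δ
                = hsDiameter σ N ^ 2 * (Real.sqrt θ * Δ) := by ring
              _ ≤ (hsDiameter σ N + Λ * Real.sqrt θ * Δ) ^ 2 * (hsDiameter σ N + Λ * Real.sqrt θ * Δ) :=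
                  mul_le_mul h2 h3 hx (pow_nonneg hB 2)
              _ = (hsDiameter σ N + Λ * Real.sqrt θ * Δ) ^ 3 := by ring
          calc C * (hsDiameter σ N ^ 2 * Real.sqrt θ * Δ)
              ≤ C * (hsDiameter σ N + Λ * Real.sqrt θ * Δ) ^ 3 := mul_le_mul_of_nonneg_left hcube hC
            _ ≤ max C₁ C * (hsDiameter σ N + Λ * Real.sqrt θ * Δ) ^ 3 :=
                mul_le_mul_of_nonneg_right (le_max_right _ _) (pow_nonneg hB 3)
  · -- two links or more: the open seam
    have hn : 2 ≤ n + 1 + 1 := by omega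
    calc localGibbsLaw σ (fun _ => a) (fun _ => 0) (fun _ => θ) N (Φ N) _
        ≤ ENNReal.ofReal ((C₁ * (hsDiameter σ N + Λ * Real.sqrt θ * Δ) ^ 3) ^ (n + 1 + 1)) :=
          hN M hM hMK Δ hΔ hΔε (n + 1 + 1) q T hn hq hT hT0 hTlast
      _ ≤ ENNReal.ofReal ((max C₁ C * (hsDiameter σ N + Λ * Real.sqrt θ * Δ) ^ 3) ^ (n + 1 + 1)) := by
          refine ENNReal.ofReal_le_ofReal (pow_le_pow_left₀ ?_ ?_ _)
          · exact mul_nonneg hC₁ (pow_nonneg hB 3)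
          · exact mul_le_mul_of_nonneg_right (le_max_left _ _) (pow_nonneg hB 3)

/-- `GibbsLightCone` FROM THE TWO SEAMS `X″ (n ≥ 2)` AND `Y″` (the conditional closure of the line
`Sketch`): glue H″ on `Y″`, glue L″ on `X″` assembled by `slabContactNecklaceBound_of_two_le`, then the
landed bridge `gibbsLightCone_of_hotPathLengthTail_of_linkCountTail`. [folklore] -/
theorem gibbsLightCone_of_seams :
    (∀ a θ : ℝ, 0 < a → 0 < θ → ∃ σ₀ : ℝ, 0 < σ₀ ∧ ∃ C₁ Λ : ℝ, 0 ≤ C₁ ∧ 1 ≤ Λ ∧ ∀ K : ℝ, 0 < K →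
      ∀ σ : ℝ, 0 < σ → σ < σ₀ →
      ∀ Φ : (N : ℕ) → HardSphereFlow (Torus.geometry (Fin 3)) (hsDiameter σ N) (N + 1),
      ∀ᶠ N : ℕ in atTop, ∀ M : ℝ, 1 ≤ M → M ≤ K * Real.log ((N : ℝ) + 2) →
        ∀ Δ : ℝ, 0 < Δ → Δ ≤ hsDiameter σ N / Real.sqrt θ →
        ∀ (n : ℕ) (q : Fin (n + 1) → Fin (N + 1)) (T : Fin (n + 2) → ℝ), 2 ≤ n →
          Function.Injective q → Monotone T → T 0 = 0 →
          T (Fin.last (n + 1)) = M * (((N + 1 : ℕ) : ℝ) ^ (-(1 / 3 : ℝ)) / σ ^ 2 / Real.sqrt θ) →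
        localGibbsLaw σ (fun _ => a) (fun _ => 0) (fun _ => θ) N (Φ N)
          {z | ∀ m : Fin n, ∃ u ∈ Set.Icc (T (Fin.castSucc (Fin.succ m))) (T (Fin.castSucc (Fin.succ m)) + Δ),
              s(q (Fin.castSucc m), q (Fin.succ m)) ∈
                contactPairSet (Torus.geometry (Fin 3)) (hsDiameter σ N) ((Φ N).flow u z)}
          ≤ ENNReal.ofReal ((C₁ * (hsDiameter σ N + Λ * Real.sqrt θ * Δ) ^ 3) ^ n)) →
    (∀ a θ : ℝ, 0 < a → 0 < θ → ∃ σ₀ : ℝ, 0 < σ₀ ∧ ∃ A η C₁ Λ c₂ C₂ : ℝ, 0 ≤ A ∧ 0 < η ∧ 1 ≤ Λ ∧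
      ∀ K : ℝ, 0 < K →
      ∀ σ : ℝ, 0 < σ → σ < σ₀ →
      ∀ Φ : (N : ℕ) → HardSphereFlow (Torus.geometry (Fin 3)) (hsDiameter σ N) (N + 1),
      ∀ᶠ N : ℕ in atTop, ∀ M : ℝ, 1 ≤ M → M ≤ K * Real.log ((N : ℝ) + 2) →
        ∀ Δ : ℝ, 0 < Δ → Δ ≤ hsDiameter σ N / Real.sqrt θ →
        ∀ (n : ℕ) (q : Fin (n + 1) → Fin (N + 1)) (T : Fin (n + 2) → ℝ),
          Function.Injective q → Monotone T → T 0 = 0 →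
          T (Fin.last (n + 1)) = M * (((N + 1 : ℕ) : ℝ) ^ (-(1 / 3 : ℝ)) / σ ^ 2 / Real.sqrt θ) →
        ∀ y : ℝ, 0 ≤ y →
        localGibbsLaw σ (fun _ => a) (fun _ => 0) (fun _ => θ) N (Φ N)
          {z | (∀ m : Fin n, ∃ u ∈ Set.Icc (T (Fin.castSucc (Fin.succ m))) (T (Fin.castSucc (Fin.succ m)) + Δ),
              s(q (Fin.castSucc m), q (Fin.succ m)) ∈
                contactPairSet (Torus.geometry (Fin 3)) (hsDiameter σ N) ((Φ N).flow u z)) ∧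
              y * (((N + 1 : ℕ) : ℝ) ^ (-(1 / 3 : ℝ)) / σ ^ 2) <
                ∑ m : Fin (n + 1), ∫ u in T (Fin.castSucc m)..(T (Fin.succ m) + Δ),
                  (if A * Real.sqrt θ < ‖(((Φ N).flow u z) (q m)).2‖ then
                    ‖(((Φ N).flow u z) (q m)).2‖ else 0)}
          ≤ ENNReal.ofReal (C₂ * (C₁ * (hsDiameter σ N + Λ * Real.sqrt θ * Δ) ^ 3) ^ n *
              Real.exp (c₂ * M) * Real.exp (-η * y))) →
    Summit.AtomisticToContinuum.HydrodynamicLimit.Theses.RelayRaceLocality.GibbsLightCone :=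
  fun hX hY =>
  gibbsLightCone_of_hotPathLengthTail_of_linkCountTail
    (stub_hotPathLengthTail_of_tiltedSlabContactNecklaceBound hY)
    (stub_linkCountTail_of_slabContactNecklaceBound (slabContactNecklaceBound_of_two_le hX))

end Summit.AtomisticToContinuum.HydrodynamicLimit.Theorems.LogWindowTaggedTail
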